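import Summits.QuantumFields.YangMills.Theorems.LuscherReductionTwistedTraceScalingPointwiseSuperRiccati
import Summits.QuantumFields.YangMills.Theorems.LuscherReductionTwistedTraceScalingCoarseLowerDoors
import Summits.QuantumFields.YangMills.Theorems.LuscherReductionOneSiteLevelsVariational
import HarnessLib

/-!
# Two doors for the BO sub-target `ValleyBOWeakAt`: the Riccati trial state is bounded below on small action, and the abstract k = 0 FLOOR from a local sub-solution
# (lane A of S-BASE, crux `TwistedTraceScaling` stmt-QuantumFields-20203; design note `pub/ym-fleet/ym-luscher-20007-p1/COARSE-DESIGN.md` §17.4–§17.5)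

* ★ `exp_neg_mul_wilsonAction_le_stiffTrial` — `e^{−ĝ·S(U)} ≤ stiffTrial (riccatiWeight t b μ) U`, `ĝ = √(t² + 2tb/μ)`: the UPPER clause's `h ≥ c` on the valley
  (`c = e^{−2ĝη}`), from lane B's `weightForm_le_of_mul_le`, `riccatiWeight_mul_le` and `‖F(U)‖² ≤ S(U)`;
* ★★ `mul_setIntegral_sq_le_levelValue_zero_mul_l2` — the ABSTRACT FLOOR DOOR: for a physical `ψ ≥ 0` and a measurable set `B` on which `(K_β ψ)(U) ≥ m·ψ(U)`,
  `m·∫_B ψ² ≤ λ₀(β,L)·‖ψ‖²` (Rayleigh `⟨ψ,K_βψ⟩ ≤ λ₀‖ψ‖²` + positivity of the kernel: the integrand `ψ·K_βψ ≥ 0` everywhere, `≥ mψ²` on `B`);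
  ★ `mul_le_levelValue_zero_of_subsolution_on` — quotient form `m·θ ≤ λ₀` when `∫_B ψ² ≥ θ‖ψ‖² > 0`, `m ≥ 0`.
The k = 0 floor of `ValleyBOWeakAt` (C3d) is this door with `ψ = H·1_{B}` symmetrised over the 8 centre twists (`B` a gauge-invariant tube around the vacuum orbit), `m` from
lane B's LOWER model on the chart and `zpeSum_step_vacuum_le` (`…ZPEBounds`), and `θ = e^{−o(δ)}` a tube-volume ratio (§17.5).
HONEST FRAMING: doors for a stub lane of a child of the CONDITIONAL reduction route (femto rung R2b1); not infinite volume, not a gap, not Clay.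
-/

set_option autoImplicit false

noncomputable section

open MeasureTheory Real
open scoped BigOperators RealInnerProductSpace
open Literature.MathematicalPhysics.QuantumFieldTheory
open Literature.MathematicalPhysics.QuantumLattice

namespace Summit.QuantumFields.YangMills.Theorems.FemtoTransferGap

open TwoLattice TwoLattice.Cov TwoLattice.Stiff TwoLattice.Harm TwoLattice.Lower

variable {L : ℕ} [NeZero L]

/-! ## §1 The Riccati trial state is bounded below on small action -/

/-- ★ **`e^{−ĝ·S(U)} ≤ H(U)`** for `H = stiffTrial (riccatiWeight t b μ)`, `ĝ = √(t² + 2tb/μ)` (`t, b ≥ 0`, `μ > 0`): the trial exponent is at most `ĝ‖F(U)‖² ≤ ĝ·S(U)`.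
[cite: Luscher1983, §3] [cite: Wipf2021, §8.5.1] -/
theorem exp_neg_mul_wilsonAction_le_stiffTrial {t b μ : ℝ} (ht : 0 ≤ t) (hb : 0 ≤ b) (hμ : 0 < μ) (U : GaugeConfig 3 L SU2) :
    Real.exp (-(Real.sqrt (t ^ 2 + 2 * t * b / μ) * wilsonAction su2Rep U)) ≤ stiffTrial (riccatiWeight t b μ) U := by
  unfold stiffTrial
  refine Real.exp_le_exp.2 (neg_le_neg ?_)
  have h1 : weightForm (riccatiWeight t b μ) (covCurl U) (plaqCurv U) ≤ Real.sqrt (t ^ 2 + 2 * t * b / μ) * ‖plaqCurv U‖ ^ 2 :=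
    weightForm_le_of_mul_le (fun s hs => riccatiWeight_mul_le hμ ht hb hs) (covCurl U) (plaqCurv U)
  exact h1.trans (mul_le_mul_of_nonneg_left (norm_plaqCurv_sq_le_wilsonAction U) (Real.sqrt_nonneg _))

/-- On `{S ≤ σ}`: `e^{−ĝσ} ≤ H(U)`. [cite: Luscher1983, §3] -/
theorem exp_neg_mul_le_stiffTrial_of_le {t b μ σ : ℝ} (ht : 0 ≤ t) (hb : 0 ≤ b) (hμ : 0 < μ) (U : GaugeConfig 3 L SU2)
    (hS : wilsonAction su2Rep U ≤ σ) :
    Real.exp (-(Real.sqrt (t ^ 2 + 2 * t * b / μ) * σ)) ≤ stiffTrial (riccatiWeight t b μ) U := by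
  refine le_trans (Real.exp_le_exp.2 (neg_le_neg ?_)) (exp_neg_mul_wilsonAction_le_stiffTrial ht hb hμ U)
  exact mul_le_mul_of_nonneg_left hS (Real.sqrt_nonneg _)

/-! ## §2 The abstract k = 0 floor from a local sub-solution -/

/-- ★★ **ABSTRACT FLOOR DOOR.**  `ψ` physical (bounded measurable, gauge and twist invariant), `ψ ≥ 0`, `B` measurable, `(K_β ψ)(U) ≥ m·ψ(U)` for `U ∈ B`:
then `m·∫_B ψ² ≤ λ₀(β,L)·‖ψ‖²`.  (Rayleigh: `⟨ψ, K_βψ⟩ ≤ λ₀‖ψ‖²`; the integrand `ψ·K_βψ` is `≥ 0` everywhere and `≥ mψ²` on `B`.) [cite: ReedSimonIV1978, Thm. XIII.1] -/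
theorem mul_setIntegral_sq_le_levelValue_zero_mul_l2 (β : ℝ) {ψ : GaugeConfig 3 L SU2 → ℝ} (hψ : IsPhys ψ) (hψ0 : ∀ U, 0 ≤ ψ U)
    {B : Set (GaugeConfig 3 L SU2)} (hB : MeasurableSet B) {m : ℝ} (hm : ∀ U ∈ B, m * ψ U ≤ transferApply β ψ U) :
    m * ∫ U in B, ψ U ^ 2 ∂configMeasure SU2 L ≤ levelValue su2Rep L β 0 * l2 ψ ψ := by
  haveI : SecondCountableTopology SU2 := secondCountableTopology_su2
  obtain ⟨C, hC⟩ := hψ.bounded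
  obtain ⟨M, hM⟩ := exists_transferKernel_le su2Rep continuous_su2Rep β (L := L)
  have hKψm : Measurable (transferApply (L := L) β ψ) := measurable_transferApply β hψ.measurable
  have hKψb : ∀ U, |transferApply β ψ U| ≤ M * C := abs_transferApply_le β hM hψ.measurable hC
  have hK0 : ∀ U, 0 ≤ transferApply β ψ U := transferApply_nonneg β hψ0
  have hC0 : 0 ≤ C := (abs_nonneg _).trans (hC (fun _ => 1))
  -- integrability of `ψ·Kψ` and `ψ²`
  have hint : Integrable (fun U => ψ U * transferApply β ψ U) (configMeasure SU2 L) := by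
    refine Integrable.mono' (integrable_const (C * (M * C))) ((hψ.measurable.mul hKψm).aestronglyMeasurable) (ae_of_all _ fun U => ?_)
    rw [Real.norm_eq_abs, abs_mul]
    exact mul_le_mul (hC U) (hKψb U) (abs_nonneg _) hC0
  have hint2 : Integrable (fun U => ψ U ^ 2) (configMeasure SU2 L) := by
    refine Integrable.mono' (integrable_const (C * C)) ((hψ.measurable.pow_const 2).aestronglyMeasurable) (ae_of_all _ fun U => ?_)
    rw [Real.norm_eq_abs, abs_pow, pow_two]
    exact mul_le_mul (hC U) (hC U) (abs_nonneg _) hC0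
  have hl2 : l2 ψ ψ = ∫ U, ψ U ^ 2 ∂configMeasure SU2 L := by
    unfold l2; exact integral_congr_ae (ae_of_all _ fun U => by ring)
  -- `m ∫_B ψ² ≤ ∫_B ψ·Kψ ≤ ∫ ψ·Kψ = qform ψ ψ`
  have h1 : m * ∫ U in B, ψ U ^ 2 ∂configMeasure SU2 L ≤ ∫ U in B, ψ U * transferApply β ψ U ∂configMeasure SU2 L := by
    rw [← integral_const_mul]
    refine setIntegral_mono_on (hint2.const_mul m).integrableOn hint.integrableOn hB fun U hU => ?_
    have := mul_le_mul_of_nonneg_left (hm U hU) (hψ0 U)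
    nlinarith
  have h2 : ∫ U in B, ψ U * transferApply β ψ U ∂configMeasure SU2 L ≤ ∫ U, ψ U * transferApply β ψ U ∂configMeasure SU2 L :=
    setIntegral_le_integral hint (ae_of_all _ fun U => mul_nonneg (hψ0 U) (hK0 U))
  have h3 : ∫ U, ψ U * transferApply β ψ U ∂configMeasure SU2 L = qform su2Rep β ψ ψ := by
    rw [qform_eq_l2_transferApply]; rfl
  by_cases hl : 0 < l2 ψ ψ
  · have hq := qform_le_levelValue_zero_mul su2Rep continuous_su2Rep β hψ hl
    linarith
  · -- `‖ψ‖² = 0`: then `∫_B ψ² = 0`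
    have hl0 : l2 ψ ψ = 0 := le_antisymm (not_lt.1 hl) (l2_self_nonneg ψ)
    have hB0 : ∫ U in B, ψ U ^ 2 ∂configMeasure SU2 L ≤ ∫ U, ψ U ^ 2 ∂configMeasure SU2 L :=
      setIntegral_le_integral hint2 (ae_of_all _ fun U => sq_nonneg _)
    have hBn : 0 ≤ ∫ U in B, ψ U ^ 2 ∂configMeasure SU2 L := integral_nonneg fun U => sq_nonneg _
    rw [← hl2, hl0] at hB0
    have hz : ∫ U in B, ψ U ^ 2 ∂configMeasure SU2 L = 0 := le_antisymm hB0 hBn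
    rw [hz, hl0, mul_zero, mul_zero]

/-- ★ **Quotient form**: if moreover `θ·‖ψ‖² ≤ ∫_B ψ²` with `‖ψ‖² > 0` and `m ≥ 0`, then `m·θ ≤ λ₀(β,L)`. [cite: ReedSimonIV1978, Thm. XIII.1] -/
theorem mul_le_levelValue_zero_of_subsolution_on (β : ℝ) {ψ : GaugeConfig 3 L SU2 → ℝ} (hψ : IsPhys ψ) (hψ0 : ∀ U, 0 ≤ ψ U)
    {B : Set (GaugeConfig 3 L SU2)} (hB : MeasurableSet B) {m θ : ℝ} (hm0 : 0 ≤ m) (hm : ∀ U ∈ B, m * ψ U ≤ transferApply β ψ U)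
    (hl : 0 < l2 ψ ψ) (hθ : θ * l2 ψ ψ ≤ ∫ U in B, ψ U ^ 2 ∂configMeasure SU2 L) :
    m * θ ≤ levelValue su2Rep L β 0 := by
  have h := mul_setIntegral_sq_le_levelValue_zero_mul_l2 β hψ hψ0 hB hm
  have h1 : m * (θ * l2 ψ ψ) ≤ levelValue su2Rep L β 0 * l2 ψ ψ := (mul_le_mul_of_nonneg_left hθ hm0).trans h
  have h2 : (m * θ) * l2 ψ ψ ≤ levelValue su2Rep L β 0 * l2 ψ ψ := by rw [mul_assoc]; exact h1
  exact le_of_mul_le_mul_right h2 hl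

end Summit.QuantumFields.YangMills.Theorems.FemtoTransferGap

end
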